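import Mathlib
import Summits.KontsevichZagierPeriods.KontsevichZagierPeriods.Theorems.SoloInformedPellAbelQuarterQuartic
import Summits.KontsevichZagierPeriods.KontsevichZagierPeriods.Theorems.SoloInformedKummerTorsionFourNegKernel
import HarnessLib
import HarnessLib.Audit

/-!
# COROLLARY XXIX.10, negative: the order-four negative torsion packet of the third kind, in `P`

The instance of THEOREM XXXI′ (`SoloInformedPellAbelQuarterLaw`, via the quartic-unit constructor
`SoloInformedQuarticUnit.toQuarter`) along the rational curve of
`SoloInformedKummerTorsionFourNegKernel`: for real algebraic `s` with `1 < s`, `s² < 2s + 1`,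
`M = ((s²−1)/(2s))⁴`, `n = −(s−1)³(s+1)/(4s³) < 0` (negative packet, `a = iK′/4`), and ALL
representations `Π_n = [(0,1), κ_M/(1−nx²)]`, `K = [(0,1), κ_M]`:
`⟦Π_n⟧ = ⟦[pt, (3s²+2s+1)/(4(s²+1))]⟧·⟦K⟧ + ⟦[pt, s²/(2(s²+1)(s²+2s−1))]⟧·⟦π⟧` in `P`;
fibre `s = 2`: `140·Π(−3/32 | 81/256) = 119·K(81/256) + 8·π`.
-/

noncomputable section

open MeasureTheory Set Filter
open scoped Classical

open Literature.NumberTheory.Transcendental Literature.NumberTheory.Transcendental.KZ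
open Literature.ModelTheory.ExponentialFields

namespace Summit.KontsevichZagierPeriods.KontsevichZagierPeriods.Theorems

/-- **The negative order-four quartic unit** along `1 < s`, `s² < 2s+1` (`s` algebraic).
[this work] -/
def soloInformedN4Unit (s : ℝ) (hs1 : 1 < s) (hs2 : s ^ 2 < 2 * s + 1) (hsa : IsAlgebraic ℚ s) :
    SoloInformedQuarticUnit where
  m := soloInformedQ4m s
  n := soloInformedN4n s
  c := soloInformedN4c s
  g₁ := soloInformedN4g₁ s
  g₃ := soloInformedN4g₃ s
  q₀ := soloInformedN4q₀ s
  q₂ := soloInformedN4q₂ s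
  m_mem := soloInformed_q4_m_mem hs1 hs2
  n_lt := (soloInformed_n4_n_neg hs1).trans zero_lt_one
  isAlgebraic := by
    obtain ⟨hn, hc, hg₁, hg₃, hq₀, hq₂, -, -⟩ := soloInformed_n4_isAlgebraic hsa
    exact ⟨(soloInformed_q4_isAlgebraic hsa).1, hn, hc, hg₁, hg₃, hq₀, hq₂⟩
  norm := soloInformed_n4_norm (by positivity)
  num := soloInformed_n4_num (by positivity)
  g_sum_pos := (soloInformed_n4_g hs1).1
  g₃_nonpos := (soloInformed_n4_g hs1).2
  res := (soloInformed_n4_res hs1).ne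

/-- `α(s)` and `β(s)` are algebraic for algebraic `s`. [folklore] -/
theorem soloInformed_n4_consts_isAlgebraic {s : ℝ} (hsa : IsAlgebraic ℚ s) :
    IsAlgebraic ℚ (soloInformedN4alpha s) ∧ IsAlgebraic ℚ (soloInformedN4beta s) :=
  ⟨(soloInformed_n4_isAlgebraic hsa).2.2.2.2.2.2.1, (soloInformed_n4_isAlgebraic hsa).2.2.2.2.2.2.2⟩

/-- **COROLLARY XXIX.10, negative (the order-four negative torsion packet of the third kind).**
For real algebraic `s` with `1 < s`, `s² < 2s+1`, `M = M(s)`, `n = n₋(s) < 0`: for ALL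
representations `Π_n = [(0,1), κ_M/(1−nx²)]`, `K = [(0,1), κ_M]`,
`⟦Π_n⟧ = ⟦[pt, (3s²+2s+1)/(4(s²+1))]⟧·⟦K⟧ + ⟦[pt, s²/(2(s²+1)(s²+2s−1))]⟧·⟦π⟧` in `P`. [this work] -/
theorem soloInformed_kummer_torsionFourNeg (s : ℝ) (hs1 : 1 < s) (hs2 : s ^ 2 < 2 * s + 1)
    (hsa : IsAlgebraic ℚ s) (PN K : IntegralRep 1)
    (hPNd : PN.domain = {x | x 0 ∈ Ioo (0:ℝ) 1})
    (hPNi : EqOn PN.integrand (fun x => (1 - soloInformedN4n s * x 0 ^ 2)⁻¹ *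
      ((√(1 - x 0 ^ 2))⁻¹ * (√(1 - soloInformedQ4m s * x 0 ^ 2))⁻¹)) PN.domain)
    (hKd : K.domain = {x | x 0 ∈ Ioo (0:ℝ) 1})
    (hKi : EqOn K.integrand (fun x => (√(1 - x 0 ^ 2))⁻¹ * (√(1 - soloInformedQ4m s * x 0 ^ 2))⁻¹)
      K.domain) :
    toFormalPeriod (of PN) =
      toFormalPeriod (of (IntegralRep.unit.constMul (soloInformedN4alpha s)
        (soloInformed_n4_consts_isAlgebraic hsa).1)) * toFormalPeriod (of K) +
      toFormalPeriod (of (IntegralRep.unit.constMul (soloInformedN4beta s)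
        (soloInformed_n4_consts_isAlgebraic hsa).2)) * toFormalPeriod (of piRep) := by
  obtain ⟨hα, hβ⟩ := soloInformed_n4_alpha_beta hs1
  set U := soloInformedN4Unit s hs1 hs2 hsa with hU
  have hα' : U.q₂ / (U.q₂ + U.n * U.q₀) = soloInformedN4alpha s := hα
  have hβ' : U.n / (U.q₂ + U.n * U.q₀) = soloInformedN4beta s := hβ
  have h := U.law PN K hPNd hPNi hKd hKi
  rw [h, soloInformed_pointRep_congr _ (soloInformed_n4_consts_isAlgebraic hsa).1 hα',
    soloInformed_pointRep_congr _ (soloInformed_n4_consts_isAlgebraic hsa).2 hβ']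

/-- **COROLLARY XXIX.10, negative, in values**:
`Π(n₋(s) | M(s)) = (3s²+2s+1)K(M(s))/(4(s²+1)) + s²π/(2(s²+1)(s²+2s−1))`. [this work] -/
theorem soloInformed_kummer_torsionFourNeg_value (s : ℝ) (hs1 : 1 < s) (hs2 : s ^ 2 < 2 * s + 1)
    (hsa : IsAlgebraic ℚ s) (PN K : IntegralRep 1)
    (hPNd : PN.domain = {x | x 0 ∈ Ioo (0:ℝ) 1})
    (hPNi : EqOn PN.integrand (fun x => (1 - soloInformedN4n s * x 0 ^ 2)⁻¹ *
      ((√(1 - x 0 ^ 2))⁻¹ * (√(1 - soloInformedQ4m s * x 0 ^ 2))⁻¹)) PN.domain)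
    (hKd : K.domain = {x | x 0 ∈ Ioo (0:ℝ) 1})
    (hKi : EqOn K.integrand (fun x => (√(1 - x 0 ^ 2))⁻¹ * (√(1 - soloInformedQ4m s * x 0 ^ 2))⁻¹)
      K.domain) :
    PN.value = soloInformedN4alpha s * K.value + soloInformedN4beta s * Real.pi := by
  have h := congrArg evalP (soloInformed_kummer_torsionFourNeg s hs1 hs2 hsa PN K hPNd hPNi hKd hKi)
  simpa only [map_mul, map_add, evalP_toFormalPeriod_of, IntegralRep.value_constMul,
    IntegralRep.value_unit, mul_one, piRep_value] using h

/-- **The two representations exist**, and satisfy the law. [this work] -/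
theorem soloInformed_kummer_torsionFourNeg_exists (s : ℝ) (hs1 : 1 < s) (hs2 : s ^ 2 < 2 * s + 1)
    (hsa : IsAlgebraic ℚ s) :
    ∃ PN K : IntegralRep 1,
      PN.domain = {x | x 0 ∈ Ioo (0:ℝ) 1} ∧
      (∀ x, PN.integrand x = (1 - soloInformedN4n s * x 0 ^ 2)⁻¹ *
        ((√(1 - x 0 ^ 2))⁻¹ * (√(1 - soloInformedQ4m s * x 0 ^ 2))⁻¹)) ∧
      K.domain = {x | x 0 ∈ Ioo (0:ℝ) 1} ∧
      (∀ x, K.integrand x = (√(1 - x 0 ^ 2))⁻¹ * (√(1 - soloInformedQ4m s * x 0 ^ 2))⁻¹) ∧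
      PN.value = soloInformedN4alpha s * K.value + soloInformedN4beta s * Real.pi := by
  obtain ⟨PN, K, h1, h2, h3, h4, -⟩ := (soloInformedN4Unit s hs1 hs2 hsa).law_exists
  exact ⟨PN, K, h1, h2, h3, h4, soloInformed_kummer_torsionFourNeg_value s hs1 hs2 hsa PN K h1
    (fun x _ => h2 x) h3 (fun x _ => h4 x)⟩

/-- **The fibre `s = 2`**: `140·Π(−3/32 | 81/256) = 119·K(81/256) + 8·π` for all representations.
[this work] -/
theorem soloInformed_kummer_torsionFourNeg_fibre (PN K : IntegralRep 1)
    (hPNd : PN.domain = {x | x 0 ∈ Ioo (0:ℝ) 1})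
    (hPNi : EqOn PN.integrand (fun x => (1 + 3 / 32 * x 0 ^ 2)⁻¹ *
      ((√(1 - x 0 ^ 2))⁻¹ * (√(1 - 81 / 256 * x 0 ^ 2))⁻¹)) PN.domain)
    (hKd : K.domain = {x | x 0 ∈ Ioo (0:ℝ) 1})
    (hKi : EqOn K.integrand (fun x => (√(1 - x 0 ^ 2))⁻¹ * (√(1 - 81 / 256 * x 0 ^ 2))⁻¹)
      K.domain) :
    140 * PN.value = 119 * K.value + 8 * Real.pi := by
  have hm := soloInformed_q4_two.1
  obtain ⟨hn, hα, hβ⟩ := soloInformed_n4_two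
  have h2 : IsAlgebraic ℚ (2 : ℝ) := by exact_mod_cast isAlgebraic_nat (R := ℚ) (A := ℝ) 2
  have h := soloInformed_kummer_torsionFourNeg_value 2 (by norm_num) (by norm_num) h2 PN K hPNd
    (fun x hx => (hPNi hx).trans (by rw [hm, hn]; ring)) hKd (by simp only [hm]; exact hKi)
  rw [h, hα, hβ]
  ring

end Summit.KontsevichZagierPeriods.KontsevichZagierPeriods.Theorems

end
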